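import Summits.AtomisticToContinuum.FouriersLaw.Theorems.VanishingNoiseTransferVanishingNoiseBoundJumpPerturbationCore

/-!
# Jump perturbation of a measurable Markov semigroup, III: Chapman–Kolmogorov by the number of jumps
(brick for crux stmt-AtomisticToContinuum-11976 `VanishingNoiseTransfer.VanishingNoiseBound`, line
`fekete-usc-one-length`, stub S3 `stub_noisyPositiveConductance`; worker file, wave 2)

Step III of the construction of the flip semigroup of `L + εS` as a jump perturbation of the flip-free
transition semigroup (overview in `…JumpPerturbationCore.lean`). For an ABSTRACT Dyson–Phillips family
`U n` (the two identities of `exists_dysonPhillips`) over a kernel `K` from `ℝ × X` to `X` satisfying the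
Chapman–Kolmogorov equation for nonnegative times (hypothesis `hKadd`: `P_{s+t} = P_t ∘ P_s` in
integrated form), a jump kernel `Q` and a rate `r > 0`, the family satisfies Chapman–Kolmogorov BY THE
NUMBER OF JUMPS (`lintegral_U_add`):
`∫ f dU_n(s+t, x) = ∑_{k ≤ n} ∫ U_k(s, x)(dy) ∫ f dU_{n-k}(t, y)` (`s, t ≥ 0`)
— the `n` jumps in `[0, s+t]` split into `k` before time `s` and `n - k` after. Induction on `n` through
the last-jump recursion: either the last jump is before `s` and the stretch `(s, s+t]` is jump-free
(the term `k = n + 1`, using `hKadd`), or the induction hypothesis applies at the last jump (Tonelli).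
Summing over `n` gives Chapman–Kolmogorov for the perturbed kernels `∑_n U_n(t)` (sequel file).
Also the measurability lemmas `measurable_lintegral_slice`, `measurable_jumpObs`,
`measurable_lintegral_shift`, and `lintegral_congr_off_point`, `lintegral_expMeasure_indicator'`.

No definitions. Registered sub-goal: `helper_dysonPhillipsCK`. References: Ethier–Kurtz 1986, Ch. 4 §10;
folklore.
-/

noncomputable section

namespace Summit.AtomisticToContinuum.FouriersLaw.Theorems.VanishingNoiseBound.JumpPerturbation

open MeasureTheory ProbabilityTheory Filter Topology Set Function
open scoped NNReal ENNReal

variable {X : Type*} [MeasurableSpace X]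

/-- Two functions on `ℝ` that agree off one point have the same Lebesgue integral. [folklore] -/
theorem lintegral_congr_off_point {a : ℝ} {F G : ℝ → ℝ≥0∞} (h : ∀ u, u ≠ a → F u = G u) :
    ∫⁻ u, F u = ∫⁻ u, G u := by
  refine lintegral_congr_ae ?_
  have hsub : {u | ¬ F u = G u} ⊆ {a} := fun u hu => by
    by_contra hne
    exact hu (h u hne)
  exact measure_mono_null hsub (Real.volume_singleton)

/-- Time-restricted integration against `Exp_r`, Lebesgue form over the whole line:
`∫⁻ 1_A g dExp_r = ∫⁻ 1_{A ∩ (0,∞)}(s) r e^{-rs} g(s) ds`. [folklore] -/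
theorem lintegral_expMeasure_indicator' (r : ℝ) {A : Set ℝ} (hA : MeasurableSet A)
    {g : ℝ → ℝ≥0∞} (hg : Measurable g) :
    ∫⁻ s, A.indicator g s ∂(expMeasure r) =
      ∫⁻ s, (A ∩ Ioi 0).indicator (fun s => ENNReal.ofReal (r * Real.exp (-(r * s))) * g s) s := by
  rw [lintegral_expMeasure r (hg.indicator hA), ← lintegral_indicator measurableSet_Ioi]
  refine lintegral_congr fun s => ?_
  simp only [indicator, mem_Ioi, mem_inter_iff]
  by_cases h1 : 0 < s <;> by_cases h2 : s ∈ A <;> simp [h1, h2]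

section Family

variable (K : Kernel (ℝ × X) X) (Q : Kernel X X) {r : ℝ}
  (hr : 0 < r)
  (hKadd : ∀ s t : ℝ, 0 ≤ s → 0 ≤ t → ∀ (x : X) (f : X → ℝ≥0∞), Measurable f →
    ∫⁻ z, f z ∂(K (s + t, x)) = ∫⁻ y, ∫⁻ z, f z ∂(K (t, y)) ∂(K (s, x)))
  (U : ℕ → Kernel (ℝ × X) X)
  (hU0 : ∀ p : ℝ × X, 0 ≤ p.1 → U 0 p = ENNReal.ofReal (Real.exp (-(r * p.1))) • K p)
  (hUsucc : ∀ (n : ℕ) (p : ℝ × X) (f : X → ℝ≥0∞), Measurable f →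
    ∫⁻ z, f z ∂(U (n + 1) p) =
      ∫⁻ s, (Iio p.1).indicator (fun s =>
        ∫⁻ y, ∫⁻ y', ∫⁻ z, f z ∂(K (s, y')) ∂(Q y) ∂(U n (p.1 - s, p.2))) s ∂(expMeasure r))

/-- Measurability of `y ↦ ∫ f dκ(t, y)` for a kernel `κ` on `ℝ × X` at a frozen time. [folklore] -/
theorem measurable_lintegral_slice (κ : Kernel (ℝ × X) X) (t : ℝ) {f : X → ℝ≥0∞} (hf : Measurable f) :
    Measurable fun y : X => ∫⁻ z, f z ∂(κ (t, y)) := by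
  have : Measurable fun y : X => ∫⁻ z, f z ∂((κ.comap (fun y : X => (t, y)) measurable_prodMk_left) y) :=
    hf.lintegral_kernel
  simpa only [Kernel.comap_apply] using this

/-- Joint measurability of the one-jump observable `(s, y) ↦ ∫ Q(y, dy') ∫ P_s(y', dz) f(z)`. [folklore] -/
theorem measurable_jumpObs [IsSFiniteKernel Q] {f : X → ℝ≥0∞} (hf : Measurable f) :
    Measurable fun q : ℝ × X => ∫⁻ y', ∫⁻ z, f z ∂(K (q.1, y')) ∂(Q q.2) := by
  have hi : Measurable fun w : (ℝ × X) × X => ∫⁻ z, f z ∂(K (w.1.1, w.2)) := by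
    have : Measurable fun w : (ℝ × X) × X => ∫⁻ z, f z ∂((K.comap
        (fun w : (ℝ × X) × X => (w.1.1, w.2)) (by fun_prop)) w) := hf.lintegral_kernel
    simpa only [Kernel.comap_apply] using this
  have : Measurable fun v : ℝ × X => ∫⁻ y', (fun w : (ℝ × X) × X => ∫⁻ z, f z ∂(K (w.1.1, w.2)))
      (v, y') ∂((Q.comap (fun v : ℝ × X => v.2) measurable_snd) v) :=
    hi.lintegral_kernel_prod_right'
  simpa only [Kernel.comap_apply] using this

/-- Joint measurability of `(s, y) ↦ ∫ G(s, w) dκ(t - s, y)` for a kernel `κ` on `ℝ × X` and a jointly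
measurable `G`. [folklore] -/
theorem measurable_lintegral_shift (κ : Kernel (ℝ × X) X) [IsSFiniteKernel κ] (t : ℝ)
    {G : ℝ × X → ℝ≥0∞} (hG : Measurable G) :
    Measurable fun q : ℝ × X => ∫⁻ w, G (q.1, w) ∂(κ (t - q.1, q.2)) := by
  have hG' : Measurable fun u : (ℝ × X) × X => G (u.1.1, u.2) :=
    hG.comp ((measurable_fst.comp measurable_fst).prodMk measurable_snd)
  have h : Measurable fun q : ℝ × X => ∫⁻ w, (fun u : (ℝ × X) × X => G (u.1.1, u.2)) (q, w)
      ∂((κ.comap (fun q : ℝ × X => (t - q.1, q.2)) (by fun_prop)) q) :=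
    hG'.lintegral_kernel_prod_right'
  simpa only [Kernel.comap_apply] using h

include hr hKadd hU0 hUsucc in
/-- **Chapman–Kolmogorov for the jump expansion, by the number of jumps.** For `s, t ≥ 0`,
`U_n(s + t) = ∑_{k ≤ n} U_k(s) U_{n-k}(t)` (first `s`, then `t`): splitting the `n` jumps in
`[0, s + t]` into the `k` jumps before time `s` and the `n - k` after. Induction on `n` through the
last-jump recursion: if the last jump falls before `s` the whole `(s, s+t]` stretch is jump-free
(`U_0(t)` after `U_{n+1}(s)`), otherwise the induction hypothesis applies to the state at the last
jump. [Ethier–Kurtz 1986, Ch. 4 §10; folklore] -/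
theorem lintegral_U_add [IsSFiniteKernel Q] [∀ n, IsFiniteKernel (U n)] (n : ℕ) {s t : ℝ} (hs : 0 ≤ s)
    (ht : 0 ≤ t) (x : X) {f : X → ℝ≥0∞} (hf : Measurable f) :
    ∫⁻ z, f z ∂(U n (s + t, x)) =
      ∑ k ∈ Finset.range (n + 1), ∫⁻ y, (∫⁻ z, f z ∂(U (n - k) (t, y))) ∂(U k (s, x)) := by
  haveI := isProbabilityMeasure_expMeasure hr
  induction n generalizing s t x f with
  | zero =>
    rw [Finset.sum_range_one, Nat.sub_zero, hU0 (s + t, x) (by positivity), lintegral_smul_measure,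
      hU0 (s, x) hs, lintegral_smul_measure, smul_eq_mul, smul_eq_mul, hKadd s t hs ht x f hf]
    have hmeas : Measurable fun y => ∫⁻ z, f z ∂(K (t, y)) := measurable_lintegral_slice K t hf
    have h1 : ∀ y, ∫⁻ z, f z ∂(U 0 (t, y)) = ENNReal.ofReal (Real.exp (-(r * t))) * ∫⁻ z, f z ∂(K (t, y)) :=
      fun y => by rw [hU0 (t, y) ht, lintegral_smul_measure, smul_eq_mul]
    simp_rw [h1]
    rw [lintegral_const_mul _ hmeas, ← mul_assoc, ← ENNReal.ofReal_mul (Real.exp_nonneg _),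
      ← Real.exp_add]
    congr 2
    ring
  | succ n ih =>
    -- the one-jump observable and its measurability
    set F : ℝ × X → ℝ≥0∞ := fun q => ∫⁻ y', ∫⁻ z, f z ∂(K (q.1, y')) ∂(Q q.2) with hF
    have hFm : Measurable F := measurable_jumpObs K Q hf
    rw [hUsucc n (s + t, x) f hf]
    -- split the time since the last jump at `t`
    have hsplit : ∀ σ, (Iio (s + t)).indicator (fun σ =>
        ∫⁻ y, ∫⁻ y', ∫⁻ z, f z ∂(K (σ, y')) ∂(Q y) ∂(U n (s + t - σ, x))) σ =
        (Iio t).indicator (fun σ => ∫⁻ y, F (σ, y) ∂(U n (s + t - σ, x))) σ +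
        (Ico t (s + t)).indicator (fun σ => ∫⁻ y, F (σ, y) ∂(U n (s + t - σ, x))) σ := by
      intro σ
      have hdisj : Disjoint (Iio t) (Ico t (s + t)) :=
        Set.disjoint_left.2 fun u hu hu' => (not_le.2 (mem_Iio.1 hu)) hu'.1
      have hun : Iio t ∪ Ico t (s + t) = Iio (s + t) := by
        ext u
        simp only [mem_union, mem_Iio, mem_Ico]
        constructor
        · rintro (h | h)
          · linarith
          · exact h.2
        · intro h
          by_cases hu : u < t
          · exact Or.inl hu
          · exact Or.inr ⟨not_lt.1 hu, h⟩
      rw [← hun, indicator_union_of_disjoint hdisj]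
    simp_rw [hsplit]
    have hmA : Measurable fun σ => (Iio t).indicator (fun σ => ∫⁻ y, F (σ, y) ∂(U n (s + t - σ, x))) σ := by
      refine Measurable.indicator ?_ measurableSet_Iio
      have h := measurable_lintegral_shift (U n) (s + t) hFm
      exact h.comp (measurable_id.prodMk measurable_const)
    rw [lintegral_add_left hmA]
    -- (A) last jump after time `s`: induction hypothesis at the last jump
    have hA : ∫⁻ σ, (Iio t).indicator (fun σ => ∫⁻ y, F (σ, y) ∂(U n (s + t - σ, x))) σ ∂(expMeasure r) =
        ∑ k ∈ Finset.range (n + 1), ∫⁻ y, (∫⁻ z, f z ∂(U (n - k + 1) (t, y))) ∂(U k (s, x)) := by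
      have hih : ∀ σ, (Iio t).indicator (fun σ => ∫⁻ y, F (σ, y) ∂(U n (s + t - σ, x))) σ =
          ∑ k ∈ Finset.range (n + 1), (Iio t).indicator (fun σ =>
            ∫⁻ y, (∫⁻ w, F (σ, w) ∂(U (n - k) (t - σ, y))) ∂(U k (s, x))) σ := by
        intro σ
        by_cases hσ : σ < t
        · simp only [indicator_of_mem (mem_Iio.2 hσ)]
          rw [show s + t - σ = s + (t - σ) by ring]
          exact ih hs (by linarith) x (hFm.comp (measurable_const.prodMk measurable_id))
        · simp only [indicator_of_notMem (fun h => hσ (mem_Iio.1 h)), Finset.sum_const_zero]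
      simp_rw [hih]
      rw [lintegral_finsetSum' _ fun k _ => ?_]
      · refine Finset.sum_congr rfl fun k hk => ?_
        -- Tonelli: swap the time since the last jump and the state at time `s`
        have hG : Measurable fun q : ℝ × X => (Iio t).indicator
            (fun σ => ∫⁻ w, F (σ, w) ∂(U (n - k) (t - σ, q.2))) q.1 := by
          have h1 := measurable_lintegral_shift (U (n - k)) t hFm
          have : (fun q : ℝ × X => (Iio t).indicator
              (fun σ => ∫⁻ w, F (σ, w) ∂(U (n - k) (t - σ, q.2))) q.1) =
              (Iio t ×ˢ (univ : Set X)).indicator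
                (fun q : ℝ × X => ∫⁻ w, F (q.1, w) ∂(U (n - k) (t - q.1, q.2))) := by
            funext q
            simp only [indicator, mem_prod, mem_univ, and_true, mem_Iio]
          rw [this]
          exact h1.indicator (measurableSet_Iio.prod MeasurableSet.univ)
        have hswap := lintegral_lintegral_swap (μ := expMeasure r) (ν := U k (s, x))
          (f := fun σ y => (Iio t).indicator (fun σ => ∫⁻ w, F (σ, w) ∂(U (n - k) (t - σ, y))) σ)
          (hG.aemeasurable)
        have hlhs : ∀ σ, (Iio t).indicator (fun σ =>
            ∫⁻ y, (∫⁻ w, F (σ, w) ∂(U (n - k) (t - σ, y))) ∂(U k (s, x))) σ =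
            ∫⁻ y, (Iio t).indicator (fun σ => ∫⁻ w, F (σ, w) ∂(U (n - k) (t - σ, y))) σ ∂(U k (s, x)) := by
          intro σ
          by_cases hσ : σ < t
          · simp only [indicator_of_mem (mem_Iio.2 hσ)]
          · simp only [indicator_of_notMem (fun h => hσ (mem_Iio.1 h)), lintegral_zero]
        simp_rw [hlhs]
        rw [hswap]
        refine lintegral_congr fun y => ?_
        -- the last-jump recursion at `(t, y)`, read backwards
        rw [hUsucc (n - k) (t, y) f hf]
      · -- measurability of the `k`-th summand in the time variable
        have hG2 : Measurable fun q : ℝ × X => ∫⁻ w, F (q.1, w) ∂(U (n - k) (t - q.1, q.2)) :=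
          measurable_lintegral_shift (U (n - k)) t hFm
        have h3 : Measurable fun σ : ℝ => ∫⁻ y, (∫⁻ w, F (σ, w) ∂(U (n - k) (t - σ, y))) ∂(U k (s, x)) :=
          hG2.lintegral_prod_right'
        exact (h3.indicator measurableSet_Iio).aemeasurable
    -- (B) last jump before time `s`: the stretch `(s, s + t]` is jump-free
    have hB : ∫⁻ σ, (Ico t (s + t)).indicator (fun σ => ∫⁻ y, F (σ, y) ∂(U n (s + t - σ, x))) σ
        ∂(expMeasure r) = ∫⁻ y, (∫⁻ z, f z ∂(U 0 (t, y))) ∂(U (n + 1) (s, x)) := by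
      set g : X → ℝ≥0∞ := fun y => ∫⁻ z, f z ∂(U 0 (t, y)) with hg
      have hgm : Measurable g := measurable_lintegral_slice (U 0) t hf
      have hg' : ∀ y, g y = ENNReal.ofReal (Real.exp (-(r * t))) * ∫⁻ z, f z ∂(K (t, y)) := fun y => by
        simp only [hg]
        rw [hU0 (t, y) ht, lintegral_smul_measure, smul_eq_mul]
      rw [hUsucc n (s, x) g hgm]
      -- both sides as Lebesgue integrals in the time variable
      have hmB : Measurable fun σ => ∫⁻ y, F (σ, y) ∂(U n (s + t - σ, x)) :=
        (measurable_lintegral_shift (U n) (s + t) hFm).comp (measurable_id.prodMk measurable_const)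
      have hmR : Measurable fun u => ∫⁻ y, ∫⁻ y', ∫⁻ w, g w ∂(K (u, y')) ∂(Q y) ∂(U n (s - u, x)) :=
        (measurable_lintegral_shift (U n) s (measurable_jumpObs K Q hgm)).comp
          (measurable_id.prodMk measurable_const)
      rw [lintegral_expMeasure_indicator' r measurableSet_Ico hmB,
        lintegral_expMeasure_indicator' r measurableSet_Iio hmR]
      simp only []
      rw [← lintegral_add_right_eq_self (μ := (volume : Measure ℝ))
        (fun σ => (Ico t (s + t) ∩ Ioi 0).indicator (fun σ => ENNReal.ofReal (r * Real.exp (-(r * σ))) *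
          ∫⁻ y, F (σ, y) ∂(U n (s + t - σ, x))) σ) t]
      refine lintegral_congr_off_point (a := 0) fun u hu => ?_
      -- pointwise identification off `u = 0`
      by_cases hu0 : 0 < u
      · by_cases hus : u < s
        · have hmem1 : u + t ∈ Ico t (s + t) ∩ Ioi 0 :=
            ⟨⟨by linarith, by linarith⟩, by change (0:ℝ) < u + t; linarith⟩
          have hmem2 : u ∈ Iio s ∩ Ioi 0 := ⟨hus, hu0⟩
          rw [indicator_of_mem hmem1, indicator_of_mem hmem2]
          -- `∫ g dK(u, y') = e^{-rt} ∫ f dK(u + t, y')`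
          have hK : ∀ y', ∫⁻ w, g w ∂(K (u, y')) =
              ENNReal.ofReal (Real.exp (-(r * t))) * ∫⁻ z, f z ∂(K (u + t, y')) := by
            intro y'
            simp_rw [hg']
            rw [lintegral_const_mul _ (measurable_lintegral_slice K t hf), hKadd u t hu0.le ht y' f hf]
          simp_rw [hK]
          have hc : ENNReal.ofReal (Real.exp (-(r * t))) ≠ ⊤ := ENNReal.ofReal_ne_top
          simp_rw [lintegral_const_mul' _ _ hc]
          rw [show s + t - (u + t) = s - u by ring, ← mul_assoc]
          congr 1
          · rw [← ENNReal.ofReal_mul (by positivity)]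
            congr 1
            rw [show -(r * (u + t)) = -(r * u) + -(r * t) by ring, Real.exp_add]
            ring
        · have h1 : u + t ∉ Ico t (s + t) ∩ Ioi 0 := fun h => by
            have := h.1.2; linarith
          have h2 : u ∉ Iio s ∩ Ioi 0 := fun h => hus h.1
          rw [indicator_of_notMem h1, indicator_of_notMem h2]
      · have hneg : u < 0 := lt_of_le_of_ne (not_lt.1 hu0) hu
        have h1 : u + t ∉ Ico t (s + t) ∩ Ioi 0 := fun h => by
          have := h.1.1; linarith
        have h2 : u ∉ Iio s ∩ Ioi 0 := fun h => by
          have := h.2; change (0:ℝ) < u at this; linarith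
        rw [indicator_of_notMem h1, indicator_of_notMem h2]
    rw [hA, hB]
    symm
    rw [Finset.sum_range_succ, Nat.sub_self]
    congr 1
    refine Finset.sum_congr rfl fun k hk => ?_
    have hk' : k ≤ n := Nat.lt_succ_iff.mp (Finset.mem_range.mp hk)
    rw [show n + 1 - k = n - k + 1 by omega]

end Family

/-- **Registered sub-goal `helper_dysonPhillipsCK`** of stmt-AtomisticToContinuum-11976 (brick for stub S3
`stub_noisyPositiveConductance`): `lintegral_U_add` (Chapman–Kolmogorov of the jump expansion by the number
of jumps) on the phase space of the `N`-particle chain, fully quantified and notation-free. [folklore] -/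
theorem helper_dysonPhillipsCK : ∀ (N : ℕ) (K : ProbabilityTheory.Kernel (ℝ × Literature.MathematicalPhysics.KineticTheory.HeatConduction.PhaseSpace N) (Literature.MathematicalPhysics.KineticTheory.HeatConduction.PhaseSpace N)) (Q : ProbabilityTheory.Kernel (Literature.MathematicalPhysics.KineticTheory.HeatConduction.PhaseSpace N) (Literature.MathematicalPhysics.KineticTheory.HeatConduction.PhaseSpace N)) [ProbabilityTheory.IsSFiniteKernel Q] (r : ℝ), 0 < r → (∀ s t : ℝ, 0 ≤ s → 0 ≤ t → ∀ (x : Literature.MathematicalPhysics.KineticTheory.HeatConduction.PhaseSpace N) (f : Literature.MathematicalPhysics.KineticTheory.HeatConduction.PhaseSpace N → ENNReal), Measurable f → MeasureTheory.lintegral (K (s + t, x)) (fun z => f z) = MeasureTheory.lintegral (K (s, x)) (fun y => MeasureTheory.lintegral (K (t, y)) (fun z => f z))) → ∀ (U : ℕ → ProbabilityTheory.Kernel (ℝ × Literature.MathematicalPhysics.KineticTheory.HeatConduction.PhaseSpace N) (Literature.MathematicalPhysics.KineticTheory.HeatConduction.PhaseSpace N)) [∀ n, ProbabilityTheory.IsFiniteKernel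 (U n)], (∀ p : ℝ × Literature.MathematicalPhysics.KineticTheory.HeatConduction.PhaseSpace N, 0 ≤ p.1 → U 0 p = ENNReal.ofReal (Real.exp (-(r * p.1))) • K p) → (∀ (n : ℕ) (p : ℝ × Literature.MathematicalPhysics.KineticTheory.HeatConduction.PhaseSpace N) (f : Literature.MathematicalPhysics.KineticTheory.HeatConduction.PhaseSpace N → ENNReal), Measurable f → MeasureTheory.lintegral (U (n + 1) p) (fun z => f z) = MeasureTheory.lintegral (ProbabilityTheory.expMeasure r) (fun s => (Set.Iio p.1).indicator (fun s => MeasureTheory.lintegral (U n (p.1 - s, p.2)) (fun y => MeasureTheory.lintegral (Q y) (fun y' => MeasureTheory.lintegral (K (s, y')) (fun z => f z)))) s)) → ∀ (n : ℕ) (s t : ℝ), 0 ≤ s → 0 ≤ t → ∀ (x : Literature.MathematicalPhysics.KineticTheory.HeatConduction.PhaseSpace N) (f : Literature.MathematicalPhysics.KineticTheory.HeatConduction.PhaseSpace N → ENNReal), Measurable f → MeasureTheory.lintegral (U n (s + t, x)) (fun z => f z) = Finset.sum (Finset.range (n + 1)) (fun k => MeasureTheory.lintegral (U k (s, x)) (fun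 y => MeasureTheory.lintegral (U (n - k) (t, y)) (fun z => f z))) :=
  fun _ K Q _ _ hr hKadd U _ hU0 hUsucc n _ _ hs ht x _ hf =>
    lintegral_U_add K Q hr hKadd U hU0 hUsucc n hs ht x hf

end Summit.AtomisticToContinuum.FouriersLaw.Theorems.VanishingNoiseBound.JumpPerturbation

end
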